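import Literature.NumberTheory.Sieve.MoebiusShiftedPrimesMinorArcWith
import HarnessLib

/-!
# Möbius on shifted primes — Proposition 5.1 of Lichtman 2020 along the PRINTED set, re-balanced

Topic `Literature/NumberTheory/Sieve`.  Part of the work on the named fact
`Literature.NumberTheory.Sieve.Lichtman2020_keyFourierEstimate` (J. D. Lichtman, *Averages of the
Möbius function on shifted primes*, Q. J. Math. 73 (2022) 729–757, doi:10.1093/qmath/haab054,
arXiv:2009.08969v2 [Lichtman2020], Theorem 2.2 as printed, i.e. along the printed typical set
`S = S(X,A,δ)` with first interval `[P₁, Q₁] = [(log X)^{33A}, H/(log X)^{4A}]`).  Page numbers refer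
to the held copy `paper:arxiv-2009.08969`.

`MoebiusShiftedPrimesTypical.lean` documents that the printed proof of Proposition 5.1 (p. 15) does not
deliver the printed saving `(log X)^{-B}`, `B = 11A`, at `P₁ = (log X)^{33A}`: honestly book-kept, the
`E₁`-term is `≍ V² P₁^{-2α} log Q₁`, and with `V ≥ (log X)^B` (forced by the error `1/V` of Lemma 4.7)
and `α < 1/4` (forced by the count (5.10)) the first interval affords `3B + 1 ≤ 66αA` only.  This file
PROVES Proposition 5.1 along the PRINTED set with the smaller saving `B = 2A + 4` (`α = 1/7`,
`T₀ = (log X)^{2B}`, `V = (log X)^B`), which is what the re-balanced major arcs of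
`MoebiusShiftedPrimesRebalancedArcs.lean` consume (threshold `h ≥ qH/(log X)^{A+2}`, mean square
`J ≪ h²Y/(log X)^{2A+4}`, no loss `Q₁/h` since `(log X)^{A+2} ≤ (log X)^{4A}`), everything else as in the
tree's proof of `Lichtman2020.dirichletMeanValue_strong` (the case `c ≥ 100`, `B = 11A`):

* `Lichtman2020.dirichletMeanValue_reb` — for `A > 5`, `δ > 0`, `H` in the regime, eventually in `X`:
  for `q ≤ (log X)^A`, `χ (mod q)`, `Y ∈ [X/(log X)^{2A+4}, X]`, `T ∈ [0, 2X]`,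
  `∫_{(log X)^{2(2A+4)}}^{T} |∑_{Y ≤ n ≤ 2Y, n ∈ S} λ(n)χ(n)n^{-1-it}|² dt ≤ C (Q₁T/Y + 1)(log X)^{-(2A+4)}`,
  from the named fact Lemma 4.5 (`Lichtman2020_primeCharacterSum`) alone (Lemmas 4.1, 4.3, 4.4, 4.7
  being proved in the tree: `prop51_fixed`).

The only step that is not a parameter substitution in the tree's proof is the count of bad intervals
(5.10) (`cardB_bound_reb`): with the explicit exponent `16` of the tree's Lemma 4.4
(`card_largeValues_primePoly_le`) the factor `exp(16 (V log T'/v₀) log log T')` must be book-kept as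
`T'^{25/(33A)}` (using `v₀ ≥ 33A V log L - 1` and `log log T' ≤ (5/4) log L`, `L = log X`), the crude
`T'^{64/(cA)}` of the tree being too large at `c = 33`; then `#bad √T' ≤ 2304 V L e^{(2/7)L^{2/3}}
(3X)^{11/14 + 25/(33A)} ≤ Y/Q₂` eventually, as `11/14 + 25/(33A) < 1` for `A > 5`.

## Source

* J. D. Lichtman, arXiv:2009.08969v2, Proposition 5.1 and §5.1, (5.7)–(5.10), pp. 14–15; Lemmas
  4.1–4.7, pp. 11–13 [Lichtman2020].
* K. Matomäki, M. Radziwiłł, Ann. of Math. (2) 183 (2016), Lemmas 8, 9, 12 [MatomakiRadziwillAnnals2016].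
-/

noncomputable section

open Finset Real Complex MeasureTheory Filter
open scoped Topology

namespace Literature.NumberTheory.Sieve.Lichtman2020

/-! ### The bound `U` for `Q_{v,2}` from Lemma 4.5, general exponent -/

/-- **(5.9) with a free exponent**: on the unit intervals above `T₀ = L^{K}` (`L = log X`, `K ≥ 0`),
`|Q_{v,2}(1+it)| ≤ 3 C₄₅⁺ L^{1-K}`, by Lemma 4.5 at scale `X' = X²` with exponent `K`
(as `UQ_bound`, which is the case `K = 22A`). [cite: Lichtman2020, (5.9)] -/
theorem UQ_bound_gen {C₄₅ A K θ : ℝ} {X : ℕ}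
    (h45 : ∀ q : ℕ, 1 ≤ q → (q : ℝ) ≤ Real.log ((X : ℝ) ^ 2) ^ A → ∀ χ : DirichletCharacter ℂ q,
      ∀ P Q : ℝ, Real.exp (Real.log ((X : ℝ) ^ 2) ^ θ) ≤ P → P ≤ Q → Q ≤ (X : ℝ) ^ 2 →
        ∀ t : ℝ, |t| ≤ (X : ℝ) ^ 2 →
        ‖∑ p ∈ (Icc ⌈P⌉₊ ⌊Q⌋₊).filter Nat.Prime, χ (p : ZMod q) * (p : ℂ) ^ (-(1 + (t : ℂ) * I))‖
          ≤ C₄₅ * (Real.log ((X : ℝ) ^ 2) / (1 + |t|) + Real.log ((X : ℝ) ^ 2) ^ (-K)))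
    (hL : 64 ≤ Real.log X) (hA : 0 < A) (hK : 0 ≤ K) {q : ℕ} (hq : 1 ≤ q)
    (hqA : (q : ℝ) ≤ Real.log X ^ A)
    (χ : DirichletCharacter ℂ q) {P₂ Q₂ V T : ℝ}
    (hP₂ : Real.exp ((2 * Real.log X) ^ θ) ≤ P₂) (hQ₂ : Q₂ ≤ X) (hT : T ≤ 2 * X)
    (v : ℕ) {n : ℕ} (hn : n ∈ Finset.Ico ⌊Real.log X ^ K⌋₊ (⌊T⌋₊ + 1))
    {t : ℝ} (ht : t ∈ Set.Icc (n : ℝ) (n + 1)) :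
    ‖blockPrimePoly (lamChi χ) P₂ Q₂ V v t‖ ≤ 3 * max C₄₅ 0 * Real.log X ^ (1 - K) := by
  obtain ⟨hX3, hX0⟩ := X_large hL
  set L := Real.log X with hLdef
  have hL1 : 1 ≤ L := by linarith
  have hL0 : 0 < L := by linarith
  have hlog2 : Real.log ((X : ℝ) ^ 2) = 2 * L := by rw [Real.log_pow]; push_cast; ring
  have hX'1 : (1 : ℝ) ≤ (X : ℝ) ^ 2 := by nlinarith
  -- `t`
  obtain ⟨ht1, ht2⟩ := ht
  rw [Finset.mem_Ico] at hn
  have hn0 : (0 : ℝ) ≤ n := Nat.cast_nonneg n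
  have htT : t ≤ 2 * X + 1 := by
    have h1 : (n : ℝ) ≤ ⌊T⌋₊ := by exact_mod_cast (show n ≤ ⌊T⌋₊ by omega)
    have h2 : (⌊T⌋₊ : ℝ) ≤ 2 * X := by
      rcases le_or_gt 0 T with h | h
      · exact (Nat.floor_le h).trans hT
      · rw [Nat.floor_of_nonpos h.le]; push_cast; positivity
    linarith
  have htabs : |t| = t := abs_of_nonneg (by linarith)
  have htX : |t| ≤ (X : ℝ) ^ 2 := by rw [htabs]; nlinarith
  have htT₀ : L ^ K ≤ 1 + |t| := by
    rw [htabs]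
    have h1 : (⌊L ^ K⌋₊ : ℝ) ≤ n := by exact_mod_cast hn.1
    have h2 : L ^ K < ⌊L ^ K⌋₊ + 1 := Nat.lt_floor_add_one _
    linarith
  -- Lemma 4.5 at scale X²
  have hqA' : (q : ℝ) ≤ Real.log ((X : ℝ) ^ 2) ^ A := by
    rw [hlog2]
    exact hqA.trans (Real.rpow_le_rpow hL0.le (by linarith) hA.le)
  have hP₂' : Real.exp (Real.log ((X : ℝ) ^ 2) ^ θ) ≤ P₂ := by rwa [hlog2]
  have hQ₂' : Q₂ ≤ (X : ℝ) ^ 2 := hQ₂.trans (by nlinarith)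
  have key := norm_blockPrimePoly_le_of_L45 (K := K) h45 hX'1 hq hqA' χ hP₂' hQ₂' (H := V) v htX
  refine key.trans ?_
  rw [hlog2]
  have hD : 0 ≤ max C₄₅ 0 := le_max_right _ _
  have hpow0 : 0 < L ^ K := Real.rpow_pos_of_pos hL0 _
  -- `2L/(1+|t|) ≤ 2 L^{1-K}` and `(2L)^{-K} ≤ L^{1-K}`
  have e1 : L ^ (1 - K) = L / L ^ K := by
    rw [Real.rpow_sub hL0, Real.rpow_one]
  have h1 : 2 * L / (1 + |t|) ≤ 2 * L ^ (1 - K) := by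
    rw [e1, mul_div_assoc]
    refine mul_le_mul_of_nonneg_left ?_ (by norm_num)
    exact div_le_div_of_nonneg_left hL0.le hpow0 htT₀
  have h2 : (2 * L) ^ (-K) ≤ L ^ (1 - K) := by
    have h3 : (2 * L) ^ (-K) ≤ L ^ (-K) :=
      Real.rpow_le_rpow_of_nonpos hL0 (by linarith) (by linarith)
    refine h3.trans ?_
    rw [Real.rpow_neg hL0.le, e1, le_div_iff₀ hpow0, inv_mul_cancel₀ hpow0.ne']
    exact hL1
  calc max C₄₅ 0 * (2 * L / (1 + |t|) + (2 * L) ^ (-K))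
      ≤ max C₄₅ 0 * (2 * L ^ (1 - K) + L ^ (1 - K)) := by gcongr
    _ = 3 * max C₄₅ 0 * L ^ (1 - K) := by ring

/-! ### The count of bad intervals at `P₁ = L^{33A}`, refined bookkeeping -/

/-- Exponentiating the additive condition: from
`log 2304 + κ log 3 + L^{2/3} + L^{1-δ/2} + (b + y + 1) log L ≤ (1-κ) L` (`L = log X`) and `s ≤ 1`,
the product bound `2304 L^{b} L exp(s L^{2/3}) (3X)^κ exp(L^{1-δ/2}) L^{y} ≤ X`. [folklore] -/
theorem exp_form_F12_gen {X : ℕ} {κ δ b y s : ℝ} (hL : 64 ≤ Real.log X) (hs1 : s ≤ 1)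
    (h : Real.log 2304 + κ * Real.log 3 + Real.log X ^ (2 / 3 : ℝ) + Real.log X ^ (1 - δ / 2)
      + (b + y + 1) * Real.log (Real.log X) ≤ (1 - κ) * Real.log X) :
    2304 * Real.log X ^ b * Real.log X * Real.exp (s * Real.log X ^ (2 / 3 : ℝ)) *
        (3 * (X : ℝ)) ^ κ * Real.exp (Real.log X ^ (1 - δ / 2)) * Real.log X ^ y ≤ X := by
  obtain ⟨hX3, hX0⟩ := X_large hL
  set L := Real.log X with hLdef
  have hL0 : 0 < L := by linarith
  have eX : (X : ℝ) = Real.exp L := (Real.exp_log hX0).symm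
  have e2 : L ^ b = Real.exp (b * Real.log L) := by
    rw [Real.rpow_def_of_pos hL0]; ring_nf
  have e4 : (3 * (X : ℝ)) ^ κ = Real.exp (κ * (Real.log 3 + L)) := by
    rw [Real.rpow_def_of_pos (by linarith), Real.log_mul (by norm_num) hX0.ne', ← hLdef]; ring_nf
  have e5 : L ^ y = Real.exp (y * Real.log L) := by
    rw [Real.rpow_def_of_pos hL0]; ring_nf
  have eq : 2304 * L ^ b * L * Real.exp (s * L ^ (2 / 3 : ℝ)) *
      (3 * (X : ℝ)) ^ κ * Real.exp (L ^ (1 - δ / 2)) * L ^ y =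
      Real.exp (Real.log 2304 + b * Real.log L + Real.log L + s * L ^ (2 / 3 : ℝ)
        + κ * (Real.log 3 + L) + L ^ (1 - δ / 2) + y * Real.log L) := by
    rw [Real.exp_add, Real.exp_add, Real.exp_add, Real.exp_add, Real.exp_add, Real.exp_add,
      Real.exp_log (by norm_num : (0 : ℝ) < 2304), Real.exp_log hL0, ← e2, ← e4, ← e5]
  rw [eq, eX, Real.exp_le_exp]
  have h23 : 0 ≤ L ^ (2 / 3 : ℝ) := Real.rpow_nonneg hL0.le _
  have hs : s * L ^ (2 / 3 : ℝ) ≤ L ^ (2 / 3 : ℝ) := by nlinarith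
  have r1 : (b + y + 1) * Real.log L = b * Real.log L + Real.log L + y * Real.log L := by ring
  have r2 : κ * (Real.log 3 + L) = κ * Real.log 3 + κ * L := by ring
  have r3 : (1 - κ) * L = L - κ * L := by ring
  rw [r1, r3] at h
  rw [r2]
  linarith

/-- From `L^{1-δ/2} + y log L ≤ (5/8) L`: `X^{3/8} exp(L^{1-δ/2}) L^{y} ≤ X` (as `exp_form_F8`, free
exponent `y`). [folklore] -/
theorem exp_form_F8_gen {X : ℕ} {δ y : ℝ} (hL : 64 ≤ Real.log X)
    (h : Real.log X ^ (1 - δ / 2) + y * Real.log (Real.log X) ≤ 5 / 8 * Real.log X) :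
    (X : ℝ) ^ (3 / 8 : ℝ) * Real.exp (Real.log X ^ (1 - δ / 2)) * Real.log X ^ y ≤ X := by
  obtain ⟨hX3, hX0⟩ := X_large hL
  set L := Real.log X with hLdef
  have hL0 : 0 < L := by linarith
  have eX : (X : ℝ) = Real.exp L := (Real.exp_log hX0).symm
  have e1 : (X : ℝ) ^ (3 / 8 : ℝ) = Real.exp (3 / 8 * L) := by
    rw [Real.rpow_def_of_pos hX0, ← hLdef]; ring_nf
  have e5 : L ^ y = Real.exp (y * Real.log L) := by
    rw [Real.rpow_def_of_pos hL0]; ring_nf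
  have eq : (X : ℝ) ^ (3 / 8 : ℝ) * Real.exp (L ^ (1 - δ / 2)) * L ^ y =
      Real.exp (3 / 8 * L + L ^ (1 - δ / 2) + y * Real.log L) := by
    rw [Real.exp_add, Real.exp_add, ← e1, ← e5]
  rw [eq, eX, Real.exp_le_exp]
  linarith

set_option maxHeartbeats 1600000 in
-- explicit-constant bookkeeping for the count of bad intervals
/-- **(5.10) at a large `X`, first interval `[L^{33A}, H/L^{4A}]`** (as `cardB_bound`, with the
exponential factor of the explicit Lemma 4.4 book-kept as `T'^{25/(33A)}`): every set `B` of bad unit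
intervals below `T' = ⌊T⌋ + 1 ≤ 3X` has `#B √T' ≤ Y/Q₂`: for `T' ≤ X^{1/4}` trivially (`#B ≤ T'`,
`X^{3/8} Q₂ L^{y} ≤ X`), otherwise by `card_bad_le` (`#ℐ₁ ≤ 2VL`, `Q₁^{2α} ≤ exp(2α L^{2/3})`, `T' ≤ 3X`, and
`exp(16 (V log T'/v₀) log log T') ≤ T'^{25/(33A)}` as `v₀ ≥ 33A V log L - 1`, `log log T' ≤ (5/4) log L`).
[cite: Lichtman2020, (5.10)] -/
theorem cardB_bound_reb {q : ℕ} (χ : DirichletCharacter ℂ q) {A b y α : ℝ} {X Hx n₀ : ℕ}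
    {Y T Q₂ : ℝ} (hL : 64 ≤ Real.log X) (hA : 1 ≤ A) (hb : 1 ≤ b) (hα0 : 0 < α)
    (hHx : (Hx : ℝ) ≤ Real.exp (Real.log X ^ (2 / 3 : ℝ)))
    (hPQ₁ : Real.log X ^ (33 * A) ≤ (Hx : ℝ) / Real.log X ^ (4 * A))
    (hT2X : T ≤ 2 * X) (hYlo : (X : ℝ) / Real.log X ^ y ≤ Y) (hQ₂1 : 1 ≤ Q₂)
    (hF8 : (X : ℝ) ^ (3 / 8 : ℝ) * Q₂ * Real.log X ^ y ≤ X)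
    (hF12 : 2304 * Real.log X ^ b * Real.log X * Real.exp (2 * α * Real.log X ^ (2 / 3 : ℝ)) *
        (3 * (X : ℝ)) ^ (2 * α + 1 / 2 + 25 / (33 * A)) * Q₂ * Real.log X ^ y ≤ X)
    (B : Finset ℕ) (hBsub : B ⊆ Finset.Ico n₀ (⌊T⌋₊ + 1))
    (hbad : ∀ n ∈ B, ∃ t ∈ Set.Icc (n : ℝ) (n + 1),
      ∃ u ∈ Icc ⌊Real.log X ^ b * Real.log (Real.log X ^ (33 * A))⌋₊
        ⌊Real.log X ^ b * Real.log ((Hx : ℝ) / Real.log X ^ (4 * A))⌋₊,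
        Real.exp (-(α * u / Real.log X ^ b)) <
          ‖blockPrimePoly (lamChi χ) (Real.log X ^ (33 * A)) ((Hx : ℝ) / Real.log X ^ (4 * A))
            (Real.log X ^ b) u t‖) :
    (#B : ℝ) * Real.sqrt ((⌊T⌋₊ : ℝ) + 1) ≤ Y / Q₂ := by
  obtain ⟨hX3, hX0⟩ := X_large hL
  obtain ⟨hlog3, hlog2⟩ := log_three_le_two
  set L := Real.log X with hLdef
  set V := L ^ b with hVdef
  set P₁ := L ^ (33 * A) with hP₁def
  set Q₁ := (Hx : ℝ) / L ^ (4 * A) with hQ₁def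
  set T' : ℝ := (⌊T⌋₊ : ℝ) + 1 with hT'def
  have hL1 : 1 ≤ L := by linarith
  have hL0 : 0 < L := by linarith
  have hX1 : (1 : ℝ) ≤ X := by linarith
  have hQ₂0 : 0 < Q₂ := by linarith
  have hV1 : 1 ≤ V := Real.one_le_rpow hL1 (by linarith)
  have hV0 : 0 < V := by linarith
  have hP₁L : L ≤ P₁ := by
    calc L = L ^ (1 : ℝ) := (Real.rpow_one L).symm
      _ ≤ L ^ (33 * A) := Real.rpow_le_rpow_of_exponent_le hL1 (by nlinarith)
  have hP₁0 : 0 < P₁ := by linarith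
  have hQ₁1 : 1 ≤ Q₁ := le_trans (by linarith) hPQ₁
  have hQ₁0 : 0 < Q₁ := by linarith
  have h4A : 1 ≤ L ^ (4 * A) := Real.one_le_rpow hL1 (by positivity)
  have hQ₁H : Q₁ ≤ Hx := div_le_self (Nat.cast_nonneg _) h4A
  have hQ₁exp : Q₁ ≤ Real.exp (L ^ (2 / 3 : ℝ)) := hQ₁H.trans hHx
  have hlogQ₁ : Real.log Q₁ ≤ L := by
    have h2 : Real.log Q₁ ≤ L ^ (2 / 3 : ℝ) := by
      rw [← Real.log_exp (L ^ (2 / 3 : ℝ))]; exact Real.log_le_log hQ₁0 hQ₁exp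
    have h3 : L ^ (2 / 3 : ℝ) ≤ L := by
      calc L ^ (2 / 3 : ℝ) ≤ L ^ (1 : ℝ) := Real.rpow_le_rpow_of_exponent_le hL1 (by norm_num)
        _ = L := Real.rpow_one L
    linarith
  -- `T'`
  have hT'1 : 1 ≤ T' := by simp [hT'def]
  have hT'0 : 0 < T' := by linarith
  have hT'3X : T' ≤ 3 * X := by
    have h1 : (⌊T⌋₊ : ℝ) ≤ max T 0 := by
      rcases le_or_gt 0 T with h | h
      · rw [max_eq_left h]; exact Nat.floor_le h
      · rw [Nat.floor_of_nonpos h.le]; simp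
    have h2 : max T 0 ≤ 2 * X := max_le hT2X (by positivity)
    simp only [hT'def]; linarith
  -- the target through `X/(L^{y} Q₂) ≤ Y/Q₂`
  have hyA : 0 < L ^ y := Real.rpow_pos_of_pos hL0 _
  have hgoal : ∀ Z : ℝ, Z * Q₂ * L ^ y ≤ X → Z ≤ Y / Q₂ := by
    intro Z hZ
    rw [le_div_iff₀ hQ₂0]
    have h1 : Z * Q₂ ≤ X / L ^ y := by
      rw [le_div_iff₀ hyA]; exact hZ
    exact h1.trans hYlo
  -- two cases
  rcases le_or_gt T' ((X : ℝ) ^ (1 / 4 : ℝ)) with hsmall | hlarge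
  · -- trivial count
    apply hgoal
    have hcard : (#B : ℝ) ≤ T' := by
      have h1 := Finset.card_le_card hBsub
      rw [Nat.card_Ico] at h1
      have h2 : #B ≤ ⌊T⌋₊ + 1 := h1.trans (Nat.sub_le _ _)
      simp only [hT'def]; exact_mod_cast h2
    have hsq : Real.sqrt T' ≤ (X : ℝ) ^ (1 / 8 : ℝ) := by
      rw [Real.sqrt_eq_rpow]
      calc T' ^ (1 / 2 : ℝ) ≤ ((X : ℝ) ^ (1 / 4 : ℝ)) ^ (1 / 2 : ℝ) :=
            Real.rpow_le_rpow hT'0.le hsmall (by norm_num)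
        _ = (X : ℝ) ^ (1 / 8 : ℝ) := by rw [← Real.rpow_mul hX0.le]; norm_num
    have h38 : (#B : ℝ) * Real.sqrt T' ≤ (X : ℝ) ^ (3 / 8 : ℝ) := by
      calc (#B : ℝ) * Real.sqrt T' ≤ (X : ℝ) ^ (1 / 4 : ℝ) * (X : ℝ) ^ (1 / 8 : ℝ) :=
            mul_le_mul (hcard.trans hsmall) hsq (Real.sqrt_nonneg _) (Real.rpow_nonneg hX0.le _)
        _ = (X : ℝ) ^ (3 / 8 : ℝ) := by rw [← Real.rpow_add hX0]; norm_num
    calc (#B : ℝ) * Real.sqrt T' * Q₂ * L ^ y ≤ (X : ℝ) ^ (3 / 8 : ℝ) * Q₂ * L ^ y := by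
          gcongr
      _ ≤ X := hF8
  · -- Lemma 8 count
    apply hgoal
    set v₀ := ⌊V * Real.log P₁⌋₊ with hv₀def
    have hlogP₁ : Real.log P₁ = 33 * A * Real.log L := by
      rw [hP₁def, Real.log_rpow hL0]
    have hlogL : 4 ≤ Real.log L := by
      have h1 : Real.log 64 ≤ Real.log L := Real.log_le_log (by norm_num) hL
      have h2 : (4 : ℝ) ≤ Real.log 64 := by
        rw [Real.le_log_iff_exp_le (by norm_num)]
        have he := Real.exp_one_lt_d9
        have hsq : Real.exp 1 ^ 2 ≤ 7.39 := by nlinarith [Real.exp_pos 1]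
        have h4 : Real.exp 4 = (Real.exp 1 ^ 2) ^ 2 := by
          rw [← pow_mul, ← Real.exp_nat_mul]; norm_num
        rw [h4]; nlinarith [hsq, pow_nonneg (Real.exp_pos 1).le 2]
      linarith
    have hlogL0 : 0 < Real.log L := by linarith
    have hVlogP₁ : 2 ≤ V * Real.log P₁ := by
      rw [hlogP₁]
      have h1 : 132 ≤ 33 * A * Real.log L := by nlinarith
      calc (2 : ℝ) ≤ 1 * 132 := by norm_num
        _ ≤ V * (33 * A * Real.log L) := mul_le_mul hV1 h1 (by norm_num) hV0.le
    have hv₀1 : 1 ≤ v₀ := by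
      rw [hv₀def, Nat.one_le_floor_iff]; linarith
    have hv₀ge : V * (33 * A * Real.log L) - 1 ≤ (v₀ : ℝ) := by
      have := Nat.lt_floor_add_one (V * Real.log P₁)
      rw [hlogP₁] at this
      rw [hv₀def, hlogP₁]; linarith
    have hv₀0 : (0 : ℝ) < v₀ := by exact_mod_cast hv₀1
    -- blocks of the first interval in the range of Lemma 8
    have hXquarter : Real.exp (L ^ (2 / 3 : ℝ)) ≤ (X : ℝ) ^ (1 / 4 : ℝ) := by
      rw [Real.rpow_def_of_pos hX0, ← hLdef, Real.exp_le_exp]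
      have h13 : (4 : ℝ) ≤ L ^ (1 / 3 : ℝ) := by
        have : (64 : ℝ) ^ (1 / 3 : ℝ) ≤ L ^ (1 / 3 : ℝ) := Real.rpow_le_rpow (by norm_num) hL (by norm_num)
        have e : (64 : ℝ) ^ (1 / 3 : ℝ) = 4 := by
          rw [show (64 : ℝ) = 4 ^ (3 : ℝ) by norm_num, ← Real.rpow_mul (by norm_num)]; norm_num
        linarith
      have e2 : L = L ^ (2 / 3 : ℝ) * L ^ (1 / 3 : ℝ) := by
        rw [← Real.rpow_add hL0]; norm_num
      have h0 : 0 ≤ L ^ (2 / 3 : ℝ) := Real.rpow_nonneg hL0.le _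
      nlinarith
    have hTe : Real.exp (Real.exp 1) ≤ T' := by
      have h1 : Real.exp (Real.exp 1) ≤ Real.exp (L ^ (2 / 3 : ℝ)) := by
        rw [Real.exp_le_exp]
        have h2 : Real.exp 1 ≤ 3 := by have := Real.exp_one_lt_d9; linarith
        have h3 : (3 : ℝ) ≤ L ^ (2 / 3 : ℝ) := by
          have : (64 : ℝ) ^ (2 / 3 : ℝ) ≤ L ^ (2 / 3 : ℝ) := Real.rpow_le_rpow (by norm_num) hL (by norm_num)
          have e : (64 : ℝ) ^ (2 / 3 : ℝ) = 16 := by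
            rw [show (64 : ℝ) = 4 ^ (3 : ℝ) by norm_num, ← Real.rpow_mul (by norm_num)]; norm_num
          linarith
        linarith
      linarith
    have hblocks : ∀ u ∈ Icc v₀ ⌊V * Real.log Q₁⌋₊, 2 ≤ Real.exp (u / V) ∧ Real.exp (u / V) ≤ T' := by
      intro u hu
      rw [Finset.mem_Icc] at hu
      constructor
      · -- `e^{u/V} ≥ e^{log P₁ - 1} ≥ P₁/3 ≥ 2`
        have h1 : Real.log P₁ - 1 ≤ (u : ℝ) / V := by
          rw [le_div_iff₀ hV0]
          have h2 : (v₀ : ℝ) ≤ u := by exact_mod_cast hu.1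
          have h3 : V * Real.log P₁ - 1 ≤ (v₀ : ℝ) := by
            have := Nat.lt_floor_add_one (V * Real.log P₁); rw [hv₀def]; linarith
          nlinarith
        have h4 : Real.exp (Real.log P₁ - 1) ≤ Real.exp (u / V) := Real.exp_le_exp.mpr h1
        have h5 : Real.exp (Real.log P₁ - 1) = P₁ / Real.exp 1 := by
          rw [Real.exp_sub, Real.exp_log hP₁0]
        have h6 : Real.exp 1 ≤ 3 := by have := Real.exp_one_lt_d9; linarith
        have h7 : 6 ≤ P₁ := by linarith
        have h8 : 2 ≤ P₁ / Real.exp 1 := by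
          rw [le_div_iff₀ (Real.exp_pos 1)]; nlinarith
        linarith
      · -- `e^{u/V} ≤ Q₁ ≤ exp(L^{2/3}) ≤ X^{1/4} < T'`
        have h1 : Real.exp (u / V) ≤ Q₁ := by
          have := exp_mul_div_le_rpow hV0 hQ₁1 zero_le_one hu.2
          simpa using this
        calc Real.exp (u / V) ≤ Q₁ := h1
          _ ≤ Real.exp (L ^ (2 / 3 : ℝ)) := hQ₁exp
          _ ≤ (X : ℝ) ^ (1 / 4 : ℝ) := hXquarter
          _ ≤ T' := hlarge.le
    have hB' : ∀ n ∈ B, n ≤ ⌊T⌋₊ ∧ ∃ t ∈ Set.Icc (n : ℝ) (n + 1), ∃ u ∈ Icc v₀ ⌊V * Real.log Q₁⌋₊,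
        Real.exp (-(α * u / V)) < ‖blockPrimePoly (lamChi χ) P₁ Q₁ V u t‖ := by
      intro n hn
      refine ⟨?_, hbad n hn⟩
      have := Finset.mem_Ico.mp (hBsub hn); omega
    have hV2 : (2 : ℝ) ≤ V := by
      calc (2 : ℝ) ≤ L := by linarith
        _ = L ^ (1 : ℝ) := (Real.rpow_one L).symm
        _ ≤ L ^ b := Real.rpow_le_rpow_of_exponent_le hL1 hb
    have key := card_bad_le (norm_lamChi_le χ) hV2 hα0 hQ₁1 hv₀1 ⌊T⌋₊ hTe hblocks B hB'
    -- bound the factors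
    have hI : (#(Icc v₀ ⌊V * Real.log Q₁⌋₊) : ℝ) ≤ 2 * V * L := by
      rw [Nat.card_Icc]
      have h1 : ((⌊V * Real.log Q₁⌋₊ + 1 - v₀ : ℕ) : ℝ) ≤ ⌊V * Real.log Q₁⌋₊ + 1 := by
        exact_mod_cast Nat.sub_le _ _
      refine h1.trans ?_
      have h2 : (⌊V * Real.log Q₁⌋₊ : ℝ) ≤ V * Real.log Q₁ :=
        Nat.floor_le (mul_nonneg hV0.le (Real.log_nonneg hQ₁1))
      have h3 : V * Real.log Q₁ ≤ V * L := mul_le_mul_of_nonneg_left hlogQ₁ hV0.le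
      have h4 : 1 ≤ V * L := by nlinarith
      linarith
    have h2α0 : 0 ≤ 2 * α := by linarith
    have hQ2α : Q₁ ^ (2 * α) ≤ Real.exp (2 * α * L ^ (2 / 3 : ℝ)) := by
      calc Q₁ ^ (2 * α) ≤ (Real.exp (L ^ (2 / 3 : ℝ))) ^ (2 * α) :=
            Real.rpow_le_rpow hQ₁0.le hQ₁exp h2α0
        _ = Real.exp (2 * α * L ^ (2 / 3 : ℝ)) := by rw [← Real.exp_mul]; ring_nf
    have h3X0 : (0 : ℝ) < 3 * X := by positivity
    have hT2α : T' ^ (2 * α) ≤ (3 * (X : ℝ)) ^ (2 * α) := Real.rpow_le_rpow hT'0.le hT'3X h2α0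
    -- the exponential factor, refined: `log log T' ≤ (5/4) log L`, `v₀ ≥ 33A V log L - 1`
    have hlogT' : 1 ≤ Real.log T' := by
      rw [← Real.log_exp 1]
      refine Real.log_le_log (Real.exp_pos 1) ?_
      have : Real.exp 1 ≤ Real.exp (Real.exp 1) :=
        Real.exp_le_exp.mpr (by have := Real.add_one_le_exp (1:ℝ); linarith)
      linarith
    have hlogT'0 : 0 ≤ Real.log T' := by linarith
    have hL16 : (16 : ℝ) ≤ L := by linarith
    have hL14 : (2 : ℝ) ≤ L ^ (1 / 4 : ℝ) := by
      have h1 : (16 : ℝ) ^ (1 / 4 : ℝ) ≤ L ^ (1 / 4 : ℝ) := Real.rpow_le_rpow (by norm_num) hL16 (by norm_num)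
      have e : (16 : ℝ) ^ (1 / 4 : ℝ) = 2 := by
        rw [show (16 : ℝ) = 2 ^ (4 : ℝ) by norm_num, ← Real.rpow_mul (by norm_num)]; norm_num
      linarith
    have hL54 : L + 2 ≤ L ^ (5 / 4 : ℝ) := by
      have e : L ^ (5 / 4 : ℝ) = L * L ^ (1 / 4 : ℝ) := by
        rw [← Real.rpow_one_add' hL0.le (by norm_num)]; norm_num
      rw [e]
      nlinarith
    have hllT' : Real.log (Real.log T') ≤ 5 / 4 * Real.log L := by
      have h1 : Real.log T' ≤ Real.log 3 + L := by
        rw [hLdef, ← Real.log_mul (by norm_num) hX0.ne']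
        exact Real.log_le_log hT'0 hT'3X
      have h2 : Real.log T' ≤ L ^ (5 / 4 : ℝ) := by linarith
      calc Real.log (Real.log T') ≤ Real.log (L ^ (5 / 4 : ℝ)) := Real.log_le_log (by linarith) h2
        _ = 5 / 4 * Real.log L := Real.log_rpow hL0 _
    have hllT'0 : 0 ≤ Real.log (Real.log T') := Real.log_nonneg hlogT'
    have hA33 : 0 < 33 * A := by linarith
    have hE : Real.exp (16 * (V * Real.log T' / v₀) * Real.log (Real.log T')) ≤
        (3 * (X : ℝ)) ^ (25 / (33 * A)) := by
      have h1 : 16 * (V * Real.log T' / v₀) * Real.log (Real.log T') ≤ 25 / (33 * A) * Real.log T' := by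
        -- `16 V log log T'/v₀ ≤ 25/(33A)`
        have h2 : 16 * V * Real.log (Real.log T') / v₀ ≤ 25 / (33 * A) := by
          rw [div_le_div_iff₀ hv₀0 hA33]
          have h3 : 16 * V * Real.log (Real.log T') * (33 * A) ≤ 16 * V * (5 / 4 * Real.log L) * (33 * A) := by
            gcongr
          have h4 : 25 * (V * (33 * A * Real.log L) - 1) ≤ 25 * v₀ := by linarith
          have h5 : 25 ≤ 165 * A * V * Real.log L := by
            have : (1 : ℝ) * 1 * 4 ≤ A * V * Real.log L :=
              mul_le_mul (mul_le_mul hA hV1 zero_le_one (by linarith)) hlogL (by norm_num)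
                (by positivity)
            linarith
          nlinarith
        have e : 16 * (V * Real.log T' / v₀) * Real.log (Real.log T') =
            (16 * V * Real.log (Real.log T') / v₀) * Real.log T' := by
          field_simp
        rw [e]
        exact mul_le_mul_of_nonneg_right h2 hlogT'0
      calc Real.exp (16 * (V * Real.log T' / v₀) * Real.log (Real.log T'))
          ≤ Real.exp (25 / (33 * A) * Real.log T') := Real.exp_le_exp.mpr h1
        _ = T' ^ (25 / (33 * A)) := by rw [Real.rpow_def_of_pos hT'0]; ring_nf
        _ ≤ (3 * (X : ℝ)) ^ (25 / (33 * A)) := Real.rpow_le_rpow hT'0.le hT'3X (by positivity)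
    have hsqrt : Real.sqrt T' ≤ (3 * (X : ℝ)) ^ (1 / 2 : ℝ) := by
      rw [Real.sqrt_eq_rpow]; exact Real.rpow_le_rpow hT'0.le hT'3X (by norm_num)
    -- assemble
    have hprod : (#B : ℝ) * Real.sqrt T' ≤
        2 * V * L * (1152 * Real.exp (2 * α * L ^ (2 / 3 : ℝ)) * (3 * (X : ℝ)) ^ (2 * α) *
          (3 * (X : ℝ)) ^ (25 / (33 * A))) * (3 * (X : ℝ)) ^ (1 / 2 : ℝ) := by
      have h1 : (#B : ℝ) ≤ 2 * V * L * (1152 * Real.exp (2 * α * L ^ (2 / 3 : ℝ)) *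
          (3 * (X : ℝ)) ^ (2 * α) * (3 * (X : ℝ)) ^ (25 / (33 * A))) := by
        refine key.trans ?_
        have hfac : 1152 * Q₁ ^ (2 * α) * T' ^ (2 * α) *
            Real.exp (16 * (V * Real.log T' / v₀) * Real.log (Real.log T')) ≤
            1152 * Real.exp (2 * α * L ^ (2 / 3 : ℝ)) * (3 * (X : ℝ)) ^ (2 * α) *
              (3 * (X : ℝ)) ^ (25 / (33 * A)) := by
          gcongr
        have hfac0 : 0 ≤ 1152 * Q₁ ^ (2 * α) * T' ^ (2 * α) *
            Real.exp (16 * (V * Real.log T' / v₀) * Real.log (Real.log T')) := by positivity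
        calc (#(Icc v₀ ⌊V * Real.log Q₁⌋₊) : ℝ) * (1152 * Q₁ ^ (2 * α) * (((⌊T⌋₊ : ℕ) : ℝ) + 1) ^ (2 * α) *
              Real.exp (16 * (V * Real.log (((⌊T⌋₊ : ℕ) : ℝ) + 1) / v₀) *
                Real.log (Real.log (((⌊T⌋₊ : ℕ) : ℝ) + 1))))
            ≤ (2 * V * L) * (1152 * Q₁ ^ (2 * α) * T' ^ (2 * α) *
              Real.exp (16 * (V * Real.log T' / v₀) * Real.log (Real.log T'))) :=
              mul_le_mul_of_nonneg_right hI hfac0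
          _ ≤ (2 * V * L) * (1152 * Real.exp (2 * α * L ^ (2 / 3 : ℝ)) * (3 * (X : ℝ)) ^ (2 * α) *
              (3 * (X : ℝ)) ^ (25 / (33 * A))) := mul_le_mul_of_nonneg_left hfac (by positivity)
      exact mul_le_mul h1 hsqrt (Real.sqrt_nonneg _) ((Nat.cast_nonneg _).trans h1)
    have hcomb : 2 * V * L * (1152 * Real.exp (2 * α * L ^ (2 / 3 : ℝ)) * (3 * (X : ℝ)) ^ (2 * α) *
          (3 * (X : ℝ)) ^ (25 / (33 * A))) * (3 * (X : ℝ)) ^ (1 / 2 : ℝ) =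
        2304 * V * L * Real.exp (2 * α * L ^ (2 / 3 : ℝ)) *
          (3 * (X : ℝ)) ^ (2 * α + 1 / 2 + 25 / (33 * A)) := by
      have e : (3 * (X : ℝ)) ^ (2 * α + 1 / 2 + 25 / (33 * A)) =
          (3 * (X : ℝ)) ^ (2 * α) * (3 * (X : ℝ)) ^ (25 / (33 * A)) * (3 * (X : ℝ)) ^ (1 / 2 : ℝ) := by
        rw [← Real.rpow_add h3X0, ← Real.rpow_add h3X0]; congr 1; ring
      rw [e]; ring
    rw [hcomb] at hprod
    calc (#B : ℝ) * Real.sqrt T' * Q₂ * L ^ y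
        ≤ 2304 * V * L * Real.exp (2 * α * L ^ (2 / 3 : ℝ)) *
            (3 * (X : ℝ)) ^ (2 * α + 1 / 2 + 25 / (33 * A)) * Q₂ * L ^ y := by
          gcongr
      _ ≤ X := hF12

/-! ### Numerics of the re-balanced parameters -/

/-- The `E₁` factor at `α = 1/7`: `V log(Q₁/P₁) e^{2/(7V)} P₁^{-2/7} (1 + 7V/2) ≤ 24 L^{-B}` for
`V = L^{B}`, `P₁ = L^{33A}`, `B = 2A + 4`, `A > 5`, `log Q₁ ≤ L` (`3B + 1 ≤ 66A/7`).
[cite: Lichtman2020, §5.1, bound for E₁] -/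
theorem E1_factor_numerics_reb {V L P₁ Q₁ A B : ℝ} (hL1 : 1 ≤ L) (hA : 5 < A) (hB : B = 2 * A + 4)
    (hV : V = L ^ B) (hP₁ : P₁ = L ^ (33 * A)) (hPQ : P₁ ≤ Q₁) (hlogQ₁ : Real.log Q₁ ≤ L) :
    (V * Real.log (Q₁ / P₁)) *
        (Real.exp (2 * (1 / 7 : ℝ) / V) * P₁ ^ (-(2 * (1 / 7 : ℝ))) * (1 + V / (2 * (1 / 7 : ℝ)))) ≤
      24 * L ^ (-B) := by
  have hL0 : 0 < L := by linarith
  have hB0 : 0 ≤ B := by rw [hB]; linarith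
  have hV1 : 1 ≤ V := by rw [hV]; exact Real.one_le_rpow hL1 hB0
  have hV0 : 0 < V := by linarith
  have hP₁1 : 1 ≤ P₁ := by rw [hP₁]; exact Real.one_le_rpow hL1 (by nlinarith)
  have hP₁0 : 0 < P₁ := by linarith
  have hQ₁0 : 0 < Q₁ := by linarith
  have hlog : Real.log (Q₁ / P₁) ≤ L := by
    rw [Real.log_div hQ₁0.ne' hP₁0.ne']
    linarith [Real.log_nonneg hP₁1]
  have hlog0 : 0 ≤ Real.log (Q₁ / P₁) := Real.log_nonneg (by rw [le_div_iff₀ hP₁0]; linarith)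
  have ha : V * Real.log (Q₁ / P₁) ≤ V * L := mul_le_mul_of_nonneg_left hlog hV0.le
  have hb : Real.exp (2 * (1 / 7 : ℝ) / V) ≤ 3 := by
    have h2 : 2 * (1 / 7 : ℝ) / V ≤ 1 := by rw [div_le_one hV0]; linarith
    have := Real.exp_one_lt_d9
    linarith [Real.exp_le_exp.mpr h2]
  have hcexp : P₁ ^ (-(2 * (1 / 7 : ℝ))) = L ^ (-(66 * A / 7)) := by
    rw [hP₁, ← Real.rpow_mul hL0.le]; congr 1; ring
  have hd : 1 + V / (2 * (1 / 7 : ℝ)) ≤ 5 * V := by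
    have : V / (2 * (1 / 7 : ℝ)) = 7 / 2 * V := by ring
    linarith
  have hL3 : 0 ≤ L ^ (-(66 * A / 7)) := Real.rpow_nonneg hL0.le _
  have hVVL : V * V * L = L ^ (2 * B + 1) := by
    rw [hV, ← Real.rpow_add hL0, ← Real.rpow_add_one hL0.ne']; congr 1; ring
  calc (V * Real.log (Q₁ / P₁)) *
        (Real.exp (2 * (1 / 7 : ℝ) / V) * P₁ ^ (-(2 * (1 / 7 : ℝ))) * (1 + V / (2 * (1 / 7 : ℝ))))
      ≤ (V * L) * (3 * L ^ (-(66 * A / 7)) * (5 * V)) := by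
        rw [hcexp]
        refine mul_le_mul ha ?_ (by positivity) (by positivity)
        exact mul_le_mul (mul_le_mul_of_nonneg_right hb hL3) hd (by positivity) (by positivity)
    _ = 15 * (V * V * L) * L ^ (-(66 * A / 7)) := by ring
    _ = 15 * L ^ (2 * B + 1 + (-(66 * A / 7))) := by
        rw [hVVL, mul_assoc, ← Real.rpow_add hL0]
    _ ≤ 15 * L ^ (-B) := by
        refine mul_le_mul_of_nonneg_left (Real.rpow_le_rpow_of_exponent_le hL1 ?_) (by norm_num)
        rw [hB]; nlinarith
    _ ≤ 24 * L ^ (-B) := by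
        have : 0 ≤ L ^ (-B) := Real.rpow_nonneg hL0.le _
        nlinarith

/-- The `E₂` factor with a free saving `B ≥ 5`: `V log(Q₂/P₂) #ℐ₂ · 10 C₉ U² log(2T') ≤ 720 C₉ D² L^{-B}`
for `V = L^{B}`, `P₂ = exp(L^{2/3+δ/2}) ≤ Q₂ = exp(L^{1-δ/2})`, `U = 3D L^{1-2B}`, `log(2T') ≤ 2L`.
[cite: Lichtman2020, §5.1, bound for E₂] -/
theorem E2_factor_numerics_gen {V L P₂ Q₂ δ B D C₉ T' : ℝ} (hL1 : 1 ≤ L) (hB : 5 ≤ B) (hδ : 0 < δ)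
    (hC₉ : 0 ≤ C₉) (hV : V = L ^ B)
    (hP₂ : P₂ = Real.exp (L ^ (2 / 3 + δ / 2))) (hQ₂ : Q₂ = Real.exp (L ^ (1 - δ / 2)))
    (hPQ₂ : P₂ ≤ Q₂) (hT'1 : 1 ≤ T') (hlog2T' : Real.log (2 * T') ≤ 2 * L) :
    (V * Real.log (Q₂ / P₂)) * ((#(Icc ⌊V * Real.log P₂⌋₊ ⌊V * Real.log Q₂⌋₊) : ℝ) *
        (10 * C₉ * (3 * D * L ^ (1 - 2 * B)) ^ 2 * Real.log (2 * T'))) ≤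
      720 * C₉ * D ^ 2 * L ^ (-B) := by
  have hL0 : 0 < L := by linarith
  have hV1 : 1 ≤ V := by rw [hV]; exact Real.one_le_rpow hL1 (by linarith)
  have hV0 : 0 < V := by linarith
  have hP₂0 : 0 < P₂ := by rw [hP₂]; exact Real.exp_pos _
  have hQ₂0 : 0 < Q₂ := by rw [hQ₂]; exact Real.exp_pos _
  have hQ₂1 : 1 ≤ Q₂ := by rw [hQ₂]; exact Real.one_le_exp (Real.rpow_nonneg hL0.le _)
  have hlogQ₂ : Real.log Q₂ = L ^ (1 - δ / 2) := by rw [hQ₂, Real.log_exp]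
  have hlogP₂ : Real.log P₂ = L ^ (2 / 3 + δ / 2) := by rw [hP₂, Real.log_exp]
  have hL1δ : L ^ (1 - δ / 2) ≤ L := by
    calc L ^ (1 - δ / 2) ≤ L ^ (1 : ℝ) := Real.rpow_le_rpow_of_exponent_le hL1 (by linarith)
      _ = L := Real.rpow_one L
  have ha : V * Real.log (Q₂ / P₂) ≤ 2 * V * L := by
    rw [Real.log_div hQ₂0.ne' hP₂0.ne', hlogQ₂, hlogP₂]
    have : 0 ≤ L ^ (2 / 3 + δ / 2) := Real.rpow_nonneg hL0.le _
    have : V * (L ^ (1 - δ / 2) - L ^ (2 / 3 + δ / 2)) ≤ V * L := by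
      apply mul_le_mul_of_nonneg_left _ hV0.le; linarith
    nlinarith
  have hb : (#(Icc ⌊V * Real.log P₂⌋₊ ⌊V * Real.log Q₂⌋₊) : ℝ) ≤ 2 * V * L := by
    rw [Nat.card_Icc]
    have h1' : ((⌊V * Real.log Q₂⌋₊ + 1 - ⌊V * Real.log P₂⌋₊ : ℕ) : ℝ) ≤ ⌊V * Real.log Q₂⌋₊ + 1 := by
      exact_mod_cast Nat.sub_le _ _
    refine h1'.trans ?_
    have h2' : (⌊V * Real.log Q₂⌋₊ : ℝ) ≤ V * Real.log Q₂ :=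
      Nat.floor_le (mul_nonneg hV0.le (Real.log_nonneg hQ₂1))
    have h3' : V * Real.log Q₂ ≤ V * L := by
      rw [hlogQ₂]; exact mul_le_mul_of_nonneg_left hL1δ hV0.le
    have h4' : 1 ≤ V * L := by nlinarith
    linarith
  have hlog0 : 0 ≤ Real.log (2 * T') := Real.log_nonneg (by linarith)
  have hU2 : (3 * D * L ^ (1 - 2 * B)) ^ 2 = 9 * D ^ 2 * L ^ (2 - 4 * B) := by
    have : (L ^ (1 - 2 * B)) ^ 2 = L ^ (2 - 4 * B) := by
      rw [← Real.rpow_natCast _ 2, ← Real.rpow_mul hL0.le]; congr 1; push_cast; ring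
    rw [mul_pow, mul_pow, this]; ring
  have hLpow0 : 0 ≤ L ^ (2 - 4 * B) := Real.rpow_nonneg hL0.le _
  have hlogd0 : 0 ≤ Real.log (Q₂ / P₂) := Real.log_nonneg (by rw [le_div_iff₀ hP₂0]; linarith)
  have hVVL : V * V * L = L ^ (2 * B + 1) := by
    rw [hV, ← Real.rpow_add hL0, ← Real.rpow_add_one hL0.ne']; congr 1; ring
  have hLL : L * L = L ^ (2 : ℝ) := by rw [Real.rpow_two, sq]
  calc (V * Real.log (Q₂ / P₂)) * ((#(Icc ⌊V * Real.log P₂⌋₊ ⌊V * Real.log Q₂⌋₊) : ℝ) *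
        (10 * C₉ * (3 * D * L ^ (1 - 2 * B)) ^ 2 * Real.log (2 * T')))
      ≤ (2 * V * L) * ((2 * V * L) * (10 * C₉ * (9 * D ^ 2 * L ^ (2 - 4 * B)) * (2 * L))) := by
        rw [hU2]
        refine mul_le_mul ha ?_ (by positivity) (by positivity)
        refine mul_le_mul hb ?_ (by positivity) (by positivity)
        exact mul_le_mul_of_nonneg_left hlog2T' (by positivity)
    _ = 720 * C₉ * D ^ 2 * ((V * V * L) * (L * L) * L ^ (2 - 4 * B)) := by ring
    _ = 720 * C₉ * D ^ 2 * L ^ (2 * B + 1 + 2 + (2 - 4 * B)) := by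
        rw [hVVL, hLL, ← Real.rpow_add hL0, ← Real.rpow_add hL0]
    _ ≤ 720 * C₉ * D ^ 2 * L ^ (-B) := by
        refine mul_le_mul_of_nonneg_left (Real.rpow_le_rpow_of_exponent_le hL1 ?_) (by positivity)
        linarith

end Literature.NumberTheory.Sieve.Lichtman2020

namespace Literature.NumberTheory.Sieve.Lichtman2020

/-- The filter by `lichtmanTypical` is the filter by the conjunction of the two factor conditions
(as `filter_lichtmanTypicalWith`). [folklore] -/
theorem filter_lichtmanTypical (X A δ H : ℝ) (R : Finset ℕ) :
    R.filter (lichtmanTypical X A δ H) =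
      R.filter (fun n => HasPrimeFactorIn (Real.log X ^ (33 * A)) (H / Real.log X ^ (4 * A)) n ∧
        HasPrimeFactorIn (Real.exp (Real.log X ^ (2 / 3 + δ / 2)))
          (Real.exp (Real.log X ^ (1 - δ / 2))) n) := by
  ext n
  simp only [Finset.mem_filter, lichtmanTypical]

set_option maxHeartbeats 3200000 in
-- the asymptotic wrapper of Proposition 5.1: many eventual side conditions, one long proof
/-- **Lichtman 2020, Proposition 5.1 along the PRINTED set `S(X,A,δ)` (first interval
`[(log X)^{33A}, H/(log X)^{4A}]`), with the saving `B = 2A + 4`** — PROVED from the named fact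
Lemma 4.5 (`Lichtman2020_primeCharacterSum`), all other inputs being proved in the tree (as in
`dirichletMeanValue_strong`).  For `A > 5`, `δ > 0`, `log H/log₂X → ∞`, `H ≤ exp((log X)^{2/3})`,
eventually in `X`: for `q ≤ (log X)^A`, `χ (mod q)`, `Y ∈ [X/(log X)^{2A+4}, 2X]`, `T ∈ [0, 2X]`,
`∫_{(log X)^{2(2A+4)}}^{T} |∑_{Y ≤ n ≤ 2Y, n ∈ S} λ(n)χ(n) n^{-1-it}|² dt ≤ C (Q₁T/Y + 1) (log X)^{-(2A+4)}`,
`Q₁ = H/(log X)^{4A}`.  Parameters: `V = (log X)^B`, `T₀ = (log X)^{2B}`, `α = 1/7`, `K = 2B` in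
Lemma 4.5; the first interval affords `3B + 1 ≤ 66A/7` (`E1_factor_numerics_reb`), the count (5.10)
is `cardB_bound_reb`.  The printed Proposition 5.1 claims `B = 11A`, which its proof does not deliver
(module docstring); `B = 2A + 4` suffices for Theorem 2.2 as printed through the re-balanced arcs.
[cite: Lichtman2020, Proposition 5.1] -/
theorem dirichletMeanValue_reb (h45 : Lichtman2020_primeCharacterSum) :
    ∀ A : ℝ, 5 < A → ∀ δ : ℝ, 0 < δ → ∀ H : ℕ → ℕ,
    Tendsto (fun X : ℕ => Real.log (H X) / Real.log (Real.log X)) atTop atTop →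
    (∀ᶠ X : ℕ in atTop, (H X : ℝ) ≤ Real.exp (Real.log X ^ (2 / 3 : ℝ))) →
    ∃ C : ℝ, ∀ᶠ X : ℕ in atTop, ∀ q : ℕ, 1 ≤ q → (q : ℝ) ≤ Real.log X ^ A →
      ∀ χ : DirichletCharacter ℂ q, ∀ Y : ℝ, (X : ℝ) / Real.log X ^ (2 * A + 4) ≤ Y → Y ≤ 2 * X →
        ∀ T : ℝ, 0 ≤ T → T ≤ 2 * X →
          ∫ t in (Real.log X ^ (2 * (2 * A + 4)))..T,
              ‖∑ n ∈ (Icc ⌈Y⌉₊ ⌊2 * Y⌋₊).filter (lichtmanTypical X A δ (H X)),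
                  ((ArithmeticFunction.liouville n : ℤ) : ℂ) * χ (n : ZMod q) *
                    (n : ℂ) ^ (-(1 + (t : ℂ) * I))‖ ^ 2
            ≤ C * (((H X : ℝ) / Real.log X ^ (4 * A)) * T / Y + 1) / Real.log X ^ (2 * A + 4) := by
  intro A hA δ hδ H hH hHcap
  obtain ⟨C₁₂, h12'⟩ := lemma12With_of_decomp MatomakiRadziwill2016_lemma12_decomp_holds
  obtain ⟨C₉, h9'⟩ := lemma9With_of Literature.NumberTheory.LFunctions.MatomakiRadziwill2016_lemma9_holds
  have hA0 : 0 < A := by linarith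
  have hA1 : 1 ≤ A := by linarith
  set B : ℝ := 2 * A + 4 with hBdef
  have hB5 : 5 ≤ B := by rw [hBdef]; linarith
  have hB1 : 1 ≤ B := by linarith
  have hB0 : 0 < B := by linarith
  obtain ⟨C₄₅, h45'⟩ := h45 A (2 * B) (2 / 3 + δ / 4) hA0 (by positivity) (by linarith)
  set D := max C₄₅ 0 with hD
  have hD0 : 0 ≤ D := le_max_right _ _
  set Cf : ℝ := max C₁₂ 0 * (2000 + 720 * max C₉ 0 * D ^ 2) with hCf
  refine ⟨Cf, ?_⟩
  set κ : ℝ := 2 * (1 / 7 : ℝ) + 1 / 2 + 25 / (33 * A) with hκdef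
  have hκ1 : 0 < 1 - κ := by
    have h1 : 25 / (33 * A) ≤ 5 / 33 := by
      rw [div_le_div_iff₀ (by positivity) (by norm_num)]; nlinarith
    rw [hκdef]; linarith
  filter_upwards [tendsto_log_natCast.eventually_ge_atTop (64 : ℝ), hHcap,
    eventually_rpow_log_le_H hH (37 * A + 1),
    eventually_small_terms 0 B (show (2 / 3 : ℝ) < 1 by norm_num) (show (2 / 3 : ℝ) < 1 by norm_num)
      one_pos,
    eventually_small_terms (Real.log 2) B (show 1 - δ / 2 < 1 by linarith)
      (show 1 - δ / 2 < 1 by linarith) one_pos,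
    eventually_small_terms 0 B (show 1 - δ / 2 < 1 by linarith) (show (2 / 3 : ℝ) < 1 by norm_num)
      (show (0 : ℝ) < 5 / 8 by norm_num),
    eventually_small_terms (Real.log 2304 + κ * Real.log 3) (B + B + 1) (show (2 / 3 : ℝ) < 1 by norm_num)
      (show 1 - δ / 2 < 1 by linarith) hκ1,
    (tendsto_natCast_atTop_atTop (R := ℝ)).eventually
      (eventually_loglog_le (2 / 3 + δ / 2) (1 / B) (by positivity) (by positivity)),
    ((tendsto_rpow_atTop (by positivity : (0 : ℝ) < δ / 4)).comp tendsto_log_natCast).eventually_ge_atTop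
      ((2 : ℝ) ^ (2 / 3 + δ / 4))]
    with X hL64 hHx hHlow hF4 hF5 hF8 hF12 hF13 hF6
  intro q hq hqA χ Y hYlo hYhi T hT0 hT2X
  obtain ⟨hX3, hX0⟩ := X_large hL64
  set L := Real.log X with hLdef
  have hL1 : 1 ≤ L := by linarith
  have hL1' : 1 < L := by linarith
  have hL0 : 0 < L := by linarith
  set Hx := H X with hHxdef
  set V := L ^ B with hVdef
  set T₀ := L ^ (2 * B) with hT₀def
  set P₁ := L ^ (33 * A) with hP₁def
  set Q₁ := (Hx : ℝ) / L ^ (4 * A) with hQ₁def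
  set P₂ := Real.exp (L ^ (2 / 3 + δ / 2)) with hP₂def
  set Q₂ := Real.exp (L ^ (1 - δ / 2)) with hQ₂def
  -- basic positivity
  have hV1 : 1 ≤ V := Real.one_le_rpow hL1 hB0.le
  have hV0 : 0 < V := by linarith
  have hV2 : 2 ≤ V := by
    calc (2 : ℝ) ≤ L := by linarith
      _ = L ^ (1 : ℝ) := (Real.rpow_one L).symm
      _ ≤ L ^ B := Real.rpow_le_rpow_of_exponent_le hL1 hB1
  have hT₀0 : 0 ≤ T₀ := Real.rpow_nonneg hL0.le _
  have hP₁1 : 1 ≤ P₁ := Real.one_le_rpow hL1 (by positivity)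
  have hP₁0 : 0 < P₁ := by linarith
  have h4A1 : 1 ≤ L ^ (4 * A) := Real.one_le_rpow hL1 (by positivity)
  have h4A0 : 0 < L ^ (4 * A) := by linarith
  have hP₂1 : 1 ≤ P₂ := Real.one_le_exp (Real.rpow_nonneg hL0.le _)
  have hQ₂1 : 1 ≤ Q₂ := Real.one_le_exp (Real.rpow_nonneg hL0.le _)
  have hQ₂0 : 0 < Q₂ := by linarith
  -- `P₁ L ≤ Q₁` from `L^{37A+1} ≤ Hx`
  have hsplit : L ^ (37 * A + 1) = P₁ * L ^ (4 * A) * L := by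
    rw [hP₁def, ← Real.rpow_add hL0, Real.rpow_add_one hL0.ne']; congr 1; ring
  have hPQ₁L : P₁ * L ≤ Q₁ := by
    rw [hQ₁def, le_div_iff₀ h4A0]
    calc P₁ * L * L ^ (4 * A) = L ^ (37 * A + 1) := by rw [hsplit]; ring
      _ ≤ Hx := hHlow
  have hPQ₁ : P₁ ≤ Q₁ := le_trans (le_mul_of_one_le_right hP₁0.le hL1) hPQ₁L
  have hQ₁1 : 1 ≤ Q₁ := hP₁1.trans hPQ₁
  have hQ₁0 : 0 < Q₁ := by linarith
  have hQ₁H : Q₁ ≤ Hx := div_le_self (Nat.cast_nonneg _) h4A1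
  -- `Hx ≤ X/L^{B} ≤ Y`
  have hF4' : Real.exp (L ^ (2 / 3 : ℝ)) * L ^ B ≤ X := by
    have h := exp_form_gen hL64 (k := 0) (a := 2 / 3) (b := B) (by
      have : 0 ≤ Real.log (X : ℝ) ^ (2 / 3 : ℝ) := Real.rpow_nonneg hL0.le _
      linarith)
    simpa using h
  have hHxY : (Hx : ℝ) ≤ X / L ^ B := by
    rw [le_div_iff₀ hV0]
    calc (Hx : ℝ) * L ^ B ≤ Real.exp (L ^ (2 / 3 : ℝ)) * L ^ B := by gcongr
      _ ≤ X := hF4'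
  have hHxX : (Hx : ℝ) ≤ X := hHxY.trans (div_le_self hX0.le hV1)
  have hQ₁Y : Q₁ ≤ Y := hQ₁H.trans (hHxY.trans hYlo)
  have hY1 : 1 ≤ Y := hQ₁1.trans hQ₁Y
  have hY0 : 0 < Y := by linarith
  have hlogQ₁ : Real.log Q₁ ≤ L := by
    calc Real.log Q₁ ≤ Real.log X := Real.log_le_log hQ₁0 (hQ₁H.trans hHxX)
      _ = L := rfl
  -- `2 Q₂ ≤ X/L^{B} ≤ Y`
  have hF5' : 2 * Q₂ * L ^ B ≤ X := by
    have h := exp_form_gen hL64 (k := Real.log 2) (a := 1 - δ / 2) (b := B) (by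
      have : 0 ≤ Real.log (X : ℝ) ^ (1 - δ / 2) := Real.rpow_nonneg hL0.le _
      linarith)
    rwa [Real.exp_log (by norm_num : (0 : ℝ) < 2)] at h
  have hQ₂Y : 2 * Q₂ ≤ Y := by
    have : 2 * Q₂ ≤ X / L ^ B := by rw [le_div_iff₀ hV0]; exact hF5'
    exact this.trans hYlo
  have hQ₂X : Q₂ ≤ X := by linarith
  -- `Q₁ < P₂`, `V ≤ P₂`, `exp((2L)^θ) ≤ P₂`
  have hQP : Q₁ < P₂ := by
    refine lt_of_le_of_lt (hQ₁H.trans hHx) ?_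
    rw [hP₂def, Real.exp_lt_exp]
    exact Real.rpow_lt_rpow_of_exponent_lt hL1' (by linarith)
  have hVP₂ : V ≤ P₂ := by
    have h1 : B * Real.log L ≤ L ^ (2 / 3 + δ / 2) := by
      have h2 : Real.log L ≤ 1 / B * L ^ (2 / 3 + δ / 2) := hF13
      have h3 := mul_le_mul_of_nonneg_left h2 hB0.le
      refine h3.trans (le_of_eq ?_)
      field_simp
    calc V = Real.exp (B * Real.log L) := by
          rw [hVdef, Real.rpow_def_of_pos hL0]; ring_nf
      _ ≤ P₂ := Real.exp_le_exp.mpr h1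
  have hP₂' : Real.exp ((2 * Real.log X) ^ (2 / 3 + δ / 4)) ≤ P₂ := by
    rw [hP₂def, Real.exp_le_exp, ← hLdef, Real.mul_rpow (by norm_num) hL0.le]
    have e : L ^ (2 / 3 + δ / 2) = L ^ (δ / 4) * L ^ (2 / 3 + δ / 4) := by
      rw [← Real.rpow_add hL0]; congr 1; ring
    rw [e]
    exact mul_le_mul_of_nonneg_right hF6 (Real.rpow_nonneg hL0.le _)
  -- the exponential forms of F8 and F12
  have hF8' : (X : ℝ) ^ (3 / 8 : ℝ) * Q₂ * L ^ B ≤ X := by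
    refine exp_form_F8_gen hL64 ?_
    have : 0 ≤ Real.log (X : ℝ) ^ (2 / 3 : ℝ) := Real.rpow_nonneg hL0.le _
    linarith
  have hF12' : 2304 * L ^ B * L * Real.exp (2 * (1 / 7 : ℝ) * L ^ (2 / 3 : ℝ)) *
      (3 * (X : ℝ)) ^ (2 * (1 / 7 : ℝ) + 1 / 2 + 25 / (33 * A)) * Q₂ * L ^ B ≤ X :=
    exp_form_F12_gen hL64 (s := 2 * (1 / 7 : ℝ)) (κ := κ) (b := B) (y := B) (δ := δ)
      (by norm_num) hF12
  -- degenerate case `P₂ > Q₂`: `S = ∅`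
  have hRHS0 : 0 ≤ Cf * (((Hx : ℝ) / L ^ (4 * A)) * T / Y + 1) / L ^ B := by
    have : 0 ≤ max C₁₂ 0 := le_max_right _ _
    have : 0 ≤ max C₉ 0 := le_max_right _ _
    positivity
  rcases lt_or_ge Q₂ P₂ with hPQ₂ | hPQ₂
  · have hempty : (Icc ⌈Y⌉₊ ⌊2 * Y⌋₊).filter (lichtmanTypical X A δ Hx) = ∅ := by
      rw [Finset.filter_eq_empty_iff]
      intro n _ hS
      obtain ⟨-, p, -, h1, h2⟩ := hS
      exact absurd (h1.trans h2) (not_le.mpr hPQ₂)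
    rw [hempty]
    simp only [Finset.sum_empty, norm_zero]
    rw [zero_pow two_ne_zero, intervalIntegral.integral_zero]
    exact hRHS0
  -- degenerate case `T < T₀`
  rcases lt_or_ge T T₀ with hTlt | hTge
  · refine le_trans ?_ hRHS0
    rw [intervalIntegral.integral_symm]
    refine neg_nonpos.mpr (intervalIntegral.integral_nonneg hTlt.le fun t _ => by positivity)
  -- the hypotheses of `prop51_fixed`
  have hX'2 : (2 : ℝ) ≤ (X : ℝ) ^ 2 := by nlinarith
  have h45X := h45' ((X : ℝ) ^ 2) hX'2
  have h2B0 : 0 ≤ 2 * B := by linarith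
  have hUQ : ∀ v ∈ Icc ⌊V * Real.log P₂⌋₊ ⌊V * Real.log Q₂⌋₊, ∀ n ∈ Finset.Ico ⌊T₀⌋₊ (⌊T⌋₊ + 1),
      ∀ t ∈ Set.Icc (n : ℝ) (n + 1),
        ‖blockPrimePoly (lamChi χ) P₂ Q₂ V v t‖ ≤ 3 * D * L ^ (1 - 2 * B) :=
    fun v _ n hn t ht => UQ_bound_gen h45X hL64 hA0 h2B0 hq hqA χ hP₂' hQ₂X hT2X v hn ht
  have hN1 : ∀ v ∈ Icc ⌊V * Real.log P₂⌋₊ ⌊V * Real.log Q₂⌋₊, 1 ≤ ⌊2 * Y * Real.exp (-(v / V))⌋₊ := by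
    intro v hv
    rw [Nat.one_le_floor_iff]
    have h1 : Y / Q₂ ≤ Y * Real.exp (-(v / V)) :=
      div_le_mul_exp_neg hY0.le hV0 hQ₂1 (Finset.mem_Icc.mp hv).2
    have h2 : 2 ≤ Y / Q₂ := by rw [le_div_iff₀ hQ₂0]; linarith
    linarith
  have hcardB : ∀ B' : Finset ℕ, B' ⊆ Finset.Ico ⌊T₀⌋₊ (⌊T⌋₊ + 1) →
      (∀ n ∈ B', ∃ t ∈ Set.Icc (n : ℝ) (n + 1), ∃ u ∈ Icc ⌊V * Real.log P₁⌋₊ ⌊V * Real.log Q₁⌋₊,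
          Real.exp (-(1 / 7 * u / V)) < ‖blockPrimePoly (lamChi χ) P₁ Q₁ V u t‖) →
      ∀ v ∈ Icc ⌊V * Real.log P₂⌋₊ ⌊V * Real.log Q₂⌋₊,
        (#B' : ℝ) * Real.sqrt ((⌊T⌋₊ : ℝ) + 1) ≤ ⌈Y * Real.exp (-(v / V))⌉₊ := by
    intro B' hBsub hbad v hv
    have h1 := cardB_bound_reb χ (α := 1 / 7) hL64 hA1 hB1 (by norm_num) hHx hPQ₁ hT2X hYlo hQ₂1
      hF8' hF12' B' hBsub hbad
    exact h1.trans (div_le_cofactorWindow hY0.le hV0 hQ₂1 (Finset.mem_Icc.mp hv).2)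
  -- the five numerical inequalities (before `key`, to keep `linarith` contexts small)
  have hsrpow : 1 / V = L ^ (-B) := by rw [hVdef, Real.rpow_neg hL0.le, one_div]
  have hT'1 : (1 : ℝ) ≤ ((⌊T⌋₊ : ℕ) : ℝ) + 1 := by simp
  have hT'0 : (0 : ℝ) < ((⌊T⌋₊ : ℕ) : ℝ) + 1 := by linarith
  have hT'T : ((⌊T⌋₊ : ℕ) : ℝ) + 1 ≤ T + 1 := by linarith [Nat.floor_le hT0]
  have hR0 : 0 ≤ Q₁ * T / Y := by positivity
  have hs0 : 0 < 1 / V := by positivity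
  have h1 : (V * Real.log (Q₁ / P₁)) *
      (Real.exp (2 * (1 / 7 : ℝ) / V) * P₁ ^ (-(2 * (1 / 7 : ℝ))) * (1 + V / (2 * (1 / 7 : ℝ)))) ≤
      24 * (1 / V) := by
    rw [hsrpow]; exact E1_factor_numerics_reb hL1 hA hBdef rfl rfl hPQ₁ hlogQ₁
  have hQT : Q₁ * (((⌊T⌋₊ : ℕ) : ℝ) + 1) / Y ≤ Q₁ * T / Y + 1 := by
    rw [div_add_one (by linarith : Y ≠ 0), div_le_div_iff_of_pos_right hY0]
    have : Q₁ * (((⌊T⌋₊ : ℕ) : ℝ) + 1) ≤ Q₁ * (T + 1) := mul_le_mul_of_nonneg_left hT'T hQ₁0.le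
    nlinarith [hQ₁Y]
  have h5 : 10 * Q₁ * (((⌊T⌋₊ : ℕ) : ℝ) + 1) / Y + 72 ≤ 82 * (Q₁ * T / Y + 1) := by
    have e : 10 * Q₁ * (((⌊T⌋₊ : ℕ) : ℝ) + 1) / Y = 10 * (Q₁ * (((⌊T⌋₊ : ℕ) : ℝ) + 1) / Y) := by ring
    rw [e]; linarith [hQT, hR0]
  have hTY : ((((⌊T⌋₊ : ℕ) : ℝ) + 1) + Y) / Y ≤ Q₁ * T / Y + 2 := by
    rw [div_le_iff₀ hY0]
    have h1' : T ≤ Q₁ * T / Y * Y := by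
      rw [div_mul_cancel₀ _ (by linarith : Y ≠ 0)]
      exact le_mul_of_one_le_left hT0 hQ₁1
    have h2' : (1 : ℝ) ≤ Y := hY1
    nlinarith [h1', h2', hT'T]
  have hVP₁ : V ≤ P₁ := Real.rpow_le_rpow_of_exponent_le hL1 (by rw [hBdef]; linarith)
  have h2 : ((((⌊T⌋₊ : ℕ) : ℝ) + 1) + Y) / Y * (1 / V + 1 / P₁) ≤ 4 * (Q₁ * T / Y + 1) * (1 / V) :=
    err_numerics hV0 hVP₁ hR0 hY0 hT'0.le hTY
  have h4 : ((((⌊T⌋₊ : ℕ) : ℝ) + 1) + Y) / Y * (1 / V + 1 / P₂) ≤ 4 * (Q₁ * T / Y + 1) * (1 / V) :=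
    err_numerics hV0 hVP₂ hR0 hY0 hT'0.le hTY
  have hlog2T' : Real.log (2 * (((⌊T⌋₊ : ℕ) : ℝ) + 1)) ≤ 2 * L := by
    have h1' : 2 * (((⌊T⌋₊ : ℕ) : ℝ) + 1) ≤ (X : ℝ) ^ 2 := by nlinarith
    calc Real.log (2 * (((⌊T⌋₊ : ℕ) : ℝ) + 1)) ≤ Real.log ((X : ℝ) ^ 2) :=
          Real.log_le_log (by linarith) h1'
      _ = 2 * L := by rw [Real.log_pow]; push_cast; ring
  have h3 : (V * Real.log (Q₂ / P₂)) * (#(Icc ⌊V * Real.log P₂⌋₊ ⌊V * Real.log Q₂⌋₊) *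
      (10 * max C₉ 0 * (3 * D * L ^ (1 - 2 * B)) ^ 2 * Real.log (2 * (((⌊T⌋₊ : ℕ) : ℝ) + 1)))) ≤
      720 * max C₉ 0 * D ^ 2 * (1 / V) := by
    rw [hsrpow]
    exact E2_factor_numerics_gen hL1 hB5 hδ (le_max_right C₉ 0) rfl rfl rfl hPQ₂ hT'1 hlog2T'
  have hK0 : 0 ≤ 10 * Q₁ * (((⌊T⌋₊ : ℕ) : ℝ) + 1) / Y + 72 := by positivity
  have hfin := final_numerics (le_max_right C₁₂ 0) (le_max_right C₉ 0) hs0.le hR0 hK0 h1 h5 h2 h3 h4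
  have hRHS : max C₁₂ 0 * (2000 + 720 * max C₉ 0 * D ^ 2) * (Q₁ * T / Y + 1) * (1 / V) =
      Cf * (Q₁ * T / Y + 1) / L ^ B := by
    rw [hCf, hVdef]; ring
  -- the main inequality at fixed `X`
  have key := prop51_fixed h12' h9' χ hY1 hT₀0 hTge hP₁1 hPQ₁ hP₂1 hPQ₂ hQP hV2
    (by norm_num : (0 : ℝ) < 1 / 7) hUQ hN1 hcardB
  rw [filter_lichtmanTypical]
  rw [← hRHS]
  exact key.trans hfin

end Literature.NumberTheory.Sieve.Lichtman2020
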